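import Summits.Ventures.Crystal3D.Theorems.StickyWulffConstantCoaxialWallLawBarlowOneFccExport
import Summits.Ventures.Crystal3D.Theorems.StickyWulffConstantCoaxialWallLawEndRowDischarge
import Summits.Ventures.Crystal3D.Theorems.StickyWulffConstantCoaxialWallLawEndRowDefsA
import Summits.Ventures.Crystal3D.Theorems.StickyWulffConstantGenericWallFloorShellCount
import HarnessLib

/-!
# The ONE-FCC F_layer cell UNDER THE CENSUS ROW (A): raw sources ≤ s_F · payer sum + rims (F_layer OneFcc, file (D) of the assembly plan)

HONEST FRAMING. Venture `Summits/Ventures/Crystal3D` (cell `crystal3d-full`); helper `--supports` the crux `CoaxialWallLaw`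
(stmt-Ventures-19481, REGISTERED line `WallLedgerF`) in its role as owner of lane T's debt T-F2 / F_layer — TexShadow v8.4's
`stub_fLayerOneFcc` (cf-p1 (civ)/(cx); HOME/wall-19481-p1/g15/ONEFCC-ASSEMBLY-PLAN-g15.md file (D)).  Inputs `KissingGap δ`,
`KissingClassification δ` and the ROW BY NAME (a hypothesis `LocalEndRowA ver sF ⟨Fr, inPlaneRoots Fr 1⟩ S₂` for ANY second system
`S₂` — the twin row of record `EndRowTwinHalfTurnA ver sF` at `L := Fr` is the instance
`S₂ = ⟨H ≫ Fr, inPlaneRoots (H ≫ Fr) (−1)⟩`); census-free; nothing about the crux is claimed; F-C1 not moved.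

`wordNet_twin_payers_ge_twoPlate_rowA` (…PayerTwinCellTwoPlateRowA) VERBATIM with `T₂ = ∅` and the export
`wordNet_barlow_endPairs_oneFcc` (…BarlowOneFccExport, p698172) in place of the fcc exports: every exported pair is an (A)-end pair of
`S₁ = ⟨Fr, inPlaneRoots Fr 1⟩` (hence of `(S₁, S₂)`), its payers lie in the window `[−(R₀+1)−2, h+(R₀+1)+2]` (the census runs at the
shifted constants `(R₀+1, ρ−1)`), and `card_endPairs_le_of_localRow` (…EndRowDischarge) discharges the local row.
* **`oneFcc_rawSources_le_payers`** — `Σ_r #sources_r ≤ sF · Σ_{PAYW} (12 − deg) + #RT · (220·#RIMT + 220·#RIMB)` (in `ℝ`), with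
  `PAYW = {z ∈ X : deg z ≤ 11, −(R₀+1)−2 ≤ z₂ ≤ h+(R₀+1)+2}`.
WHAT THIS IS NOT: not the flux (lower bound of the LHS), not the rim bounds, not the currency glue (the widened payer window costs O(ρ):
a ball with `deg ≤ 11` in the two extra height-1 bands lies within `1.71` of the lateral rim — next file); F-C1 not moved.
-/

noncomputable section

namespace Summit.Ventures.Crystal3D.Theorems

open Summit.Ventures.Crystal3D Finset
open Literature.MathematicalPhysics.StatisticalMechanics (barlowPos barlowStacking IsHaggSeq basalMirror)
open Summit.Ventures.Crystal3D.Cruxes.TextureLiminf.TexShadow (E3 stacking)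
open scoped InnerProductSpace

open scoped Classical in
/-- **The ONE-FCC cell under the (A) census row.**  See the module docstring. -/
theorem oneFcc_rawSources_le_payers (ver : WordVersion) {δ : ℝ} (hg : KissingGap δ) (hc : KissingClassification δ)
    {σ₁ σ₂ : ℤ → ℤ} (hσ₁ : IsHaggSeq σ₁) (L₁ L₂ : E3 ≃ₗᵢ[ℝ] E3) (s₁ s₂ : E3)
    (Fr : E3 ≃ₗᵢ[ℝ] E3) {t : ℤ} (hFr : (t = 1 ∧ Fr = L₁) ∨ (t = -1 ∧ Fr = basalMirror.trans L₁))
    (Gf : E3 ≃ₗᵢ[ℝ] E3) {ε : ℤ} (hGf : (ε = 1 ∧ Gf = L₂) ∨ (ε = -1 ∧ Gf = basalMirror.trans L₂))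
    (hσ₂ : ∀ n : ℤ, σ₂ n = ε)
    (hdozen : (Gf : E3 → E3) '' ↑fccSlots = (fun x => Fr (basalMirror x)) '' ↑fccSlots)
    {sF : ℝ} (S₂ : PlateSystem) (hrow : LocalEndRowA ver sF ⟨Fr, inPlaneRoots Fr 1⟩ S₂)
    (X P₁ P₂ : Finset E3) (R₀ h ρ : ℝ) (hR₀ : 5 ≤ R₀) (hρ : R₀ + 2 ≤ ρ)
    (hX : ∀ p ∈ X, ∀ q ∈ X, p ≠ q → 1 ≤ dist p q) (hP₁X : P₁ ⊆ X) (hP₂X : P₂ ⊆ X)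
    (hP₁ : ∀ p, p ∈ P₁ ↔ (p ∈ stacking L₁ s₁ σ₁ ∧ -(2 * R₀) ≤ p 2 ∧ p 2 ≤ -R₀ ∧ p 0 ^ 2 + p 1 ^ 2 ≤ ρ ^ 2))
    (hP₂ : ∀ p, p ∈ P₂ ↔ (p ∈ stacking L₂ s₂ σ₂ ∧ h + R₀ ≤ p 2 ∧ p 2 ≤ h + 2 * R₀ ∧ p 0 ^ 2 + p 1 ^ 2 ≤ ρ ^ 2)) :
    ((∑ r ∈ inPlaneRoots Fr 1,
        ((P₁.filter fun p => -(R₀ + 1) - 1 - 1 ≤ p 2 ∧ p 2 ≤ -(R₀ + 1) - 1 ∧ p 0 ^ 2 + p 1 ^ 2 ≤ (ρ - 1 - 1) ^ 2).filter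
          fun p => (∃ k i j : ℤ, p = L₁ (barlowPos 1 (Real.sqrt (2 / 3)) σ₁ k i j) + s₁ ∧ ¬ (σ₁ (k - 1) = -t ∧ σ₁ k = -t)) ∧
            -(R₀ + 1) - 1 < (p + Fr r) 2 ∧ (p + Fr r) 2 < h + (R₀ + 1) + 1).card : ℕ) : ℝ) ≤
      sF * ∑ z ∈ X.filter (fun z => (X.filter fun q => dist z q = 1).card ≤ 11 ∧
          -(R₀ + 1) - 2 ≤ z 2 ∧ z 2 ≤ h + (R₀ + 1) + 2), ((12 : ℝ) - ((X.filter fun q => dist z q = 1).card : ℝ)) +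
        ((inPlaneRoots Fr 1).card : ℝ) *
          (220 * ((X.filter fun s => h + (R₀ + 1) + 1 ≤ s 2 ∧ s 2 ≤ h + (R₀ + 1) + 1 + 1 ∧
              (ρ - 1 - 2) ^ 2 < s 0 ^ 2 + s 1 ^ 2).card : ℝ) +
            220 * ((X.filter fun s => -(R₀ + 1) - 1 - 1 ≤ s 2 ∧ s 2 < -(R₀ + 1) - 1 ∧
              (ρ - 1 - 1) ^ 2 < s 0 ^ 2 + s 1 ^ 2).card : ℝ)) := by
  obtain ⟨T, hkey, hTpair, hTpay, hTwit⟩ := wordNet_barlow_endPairs_oneFcc ver hg hc hσ₁ L₁ L₂ s₁ s₂ Fr hFr Gf hGf hσ₂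
    hdozen X P₁ P₂ R₀ h ρ hR₀ hρ hX hP₁X hP₂X hP₁ hP₂
  set S₁ : PlateSystem := ⟨Fr, inPlaneRoots Fr 1⟩ with hS₁
  -- (1) every exported pair is an (A)-end pair of `(S₁, S₂)`
  have hEP : ∀ bq ∈ T, IsEndPairA X ver S₁ S₂ bq.1 bq.2 := by
    intro bq hbq
    obtain ⟨hb, hq, -, -, -⟩ := hTpair bq hbq
    obtain ⟨r, hr, κ, hWF, hpred, hmove⟩ := hTwit bq hbq
    exact ⟨hq, hb, hTpay bq hbq, S₁.Fw κ, S₁.Fw κ (((-1 : ℝ) ^ κ.length) • r), Or.inl ⟨r, hr, κ, hWF, rfl, rfl⟩,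
      hpred, hmove⟩
  -- (2) the discharge of the local row
  set PAYW := X.filter (fun z => (X.filter fun q => dist z q = 1).card ≤ 11 ∧
    -(R₀ + 1) - 2 ≤ z 2 ∧ z 2 ≤ h + (R₀ + 1) + 2) with hPAYW
  have hTX : ∀ bq ∈ T, bq.1 ∈ X := fun bq hbq => (hTpair bq hbq).1
  have hwin : ∀ bq ∈ T, -(R₀ + 1) - 1 ≤ bq.1 2 ∧ bq.1 2 ≤ h + (R₀ + 1) + 1 := by
    intro bq hbq
    obtain ⟨-, -, -, h4, h5⟩ := hTpair bq hbq
    exact ⟨h4, h5.le⟩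
  have hclosed : ∀ bq ∈ T, ∀ z ∈ X, dist bq.1 z ≤ 1 → (X.filter fun q => dist z q = 1).card ≤ 11 → z ∈ PAYW := by
    intro bq hbq z hzX hdz hz11
    obtain ⟨h4, h5⟩ := hwin bq hbq
    have h2 : (z 2 - bq.1 2) ^ 2 ≤ 1 := by
      have := sq_sub_apply_le_dist_sq z bq.1 2
      rw [dist_comm] at hdz; nlinarith [this, hdz, dist_nonneg (x := z) (y := bq.1)]
    have h2' : |z 2 - bq.1 2| ≤ 1 := by rw [← sq_le_one_iff_abs_le_one]; exact h2
    obtain ⟨ha, hb⟩ := abs_le.1 h2'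
    exact mem_filter.2 ⟨hzX, hz11, by linarith, by linarith⟩
  have hpay : ∀ bq ∈ T, ∃ z ∈ X, dist bq.1 z ≤ 1 ∧ (X.filter fun q => dist z q = 1).card ≤ 11 := by
    intro bq hbq
    rcases hTpay bq hbq with h11 | ⟨z₁, hz₁, -, -, -, hd₁, -, hc₁, -⟩
    · exact ⟨bq.1, hTX bq hbq, by rw [dist_self]; norm_num, h11⟩
    · exact ⟨z₁, hz₁, hd₁.le, hc₁⟩
  -- the row's multiplicities dominate the pair counts
  have hmult : ∀ b, ((T.filter fun bq => bq.1 = b).card : ℝ) ≤ (endMultA X ver S₁ S₂ b : ℝ) := by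
    intro b
    have : (T.filter fun bq => bq.1 = b).card ≤ (X.filter fun q => IsEndPairA X ver S₁ S₂ b q).card := by
      refine card_le_card_of_injOn (fun bq => bq.2) (fun bq hbq => ?_) ?_
      · obtain ⟨hbqT, hb1⟩ := mem_filter.1 hbq
        have hep := hEP bq hbqT
        rw [hb1] at hep
        exact mem_coe.2 (mem_filter.2 ⟨hep.1, hep⟩)
      · intro bq hbq bq' hbq' heq
        obtain ⟨-, hb⟩ := mem_filter.1 (mem_coe.1 hbq)
        obtain ⟨-, hb'⟩ := mem_filter.1 (mem_coe.1 hbq')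
        exact Prod.ext (hb.trans hb'.symm) heq
    exact_mod_cast this
  have hDnn : ∀ b, 0 ≤ pooledDef X b := by
    intro b
    refine sum_nonneg fun z hz => ?_
    have : ((X.filter fun q => dist z q = 1).card : ℝ) ≤ 11 := by exact_mod_cast (mem_filter.1 hz).2.2
    linarith
  have hrow' : ∀ z ∈ PAYW,
      ∑ b ∈ X.filter (fun b => dist z b ≤ 1 ∧ 0 < (T.filter fun bq => bq.1 = b).card),
        ((T.filter fun bq => bq.1 = b).card : ℝ) /
          (∑ z' ∈ X.filter (fun z' => dist b z' ≤ 1 ∧ (X.filter fun q => dist z' q = 1).card ≤ 11),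
            ((12 : ℝ) - ((X.filter fun q => dist z' q = 1).card : ℝ))) ≤ sF := by
    intro z hz
    obtain ⟨hzX, hz11, -, -⟩ := mem_filter.1 hz
    have key := hrow X hX z hzX hz11
    refine le_trans ?_ key
    calc ∑ b ∈ X.filter (fun b => dist z b ≤ 1 ∧ 0 < (T.filter fun bq => bq.1 = b).card),
          ((T.filter fun bq => bq.1 = b).card : ℝ) / pooledDef X b
        ≤ ∑ b ∈ X.filter (fun b => dist z b ≤ 1 ∧ 0 < (T.filter fun bq => bq.1 = b).card),
          (endMultA X ver S₁ S₂ b : ℝ) / pooledDef X b :=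
          sum_le_sum fun b _ => div_le_div_of_nonneg_right (hmult b) (hDnn b)
      _ ≤ ∑ b ∈ X.filter (fun b => dist z b ≤ 1 ∧ 0 < endMultA X ver S₁ S₂ b),
          (endMultA X ver S₁ S₂ b : ℝ) / pooledDef X b := by
          refine sum_le_sum_of_subset_of_nonneg (fun b hb => ?_) fun b _ _ =>
            div_nonneg (Nat.cast_nonneg _) (hDnn b)
          obtain ⟨hbX, hd, hpos⟩ := mem_filter.1 hb
          refine mem_filter.2 ⟨hbX, hd, ?_⟩
          have := hmult b
          have hpos' : (0 : ℝ) < (T.filter fun bq => bq.1 = b).card := by exact_mod_cast hpos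
          exact_mod_cast (show (0 : ℝ) < endMultA X ver S₁ S₂ b by linarith)
  have key := card_endPairs_le_of_localRow T PAYW hTX (fun z hz => ⟨(mem_filter.1 hz).1, (mem_filter.1 hz).2.1⟩)
    hclosed hpay hrow'
  have hkey' : ((∑ r ∈ inPlaneRoots Fr 1,
        ((P₁.filter fun p => -(R₀ + 1) - 1 - 1 ≤ p 2 ∧ p 2 ≤ -(R₀ + 1) - 1 ∧ p 0 ^ 2 + p 1 ^ 2 ≤ (ρ - 1 - 1) ^ 2).filter
          fun p => (∃ k i j : ℤ, p = L₁ (barlowPos 1 (Real.sqrt (2 / 3)) σ₁ k i j) + s₁ ∧ ¬ (σ₁ (k - 1) = -t ∧ σ₁ k = -t)) ∧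
            -(R₀ + 1) - 1 < (p + Fr r) 2 ∧ (p + Fr r) 2 < h + (R₀ + 1) + 1).card : ℕ) : ℝ) ≤
      (T.card : ℝ) + ((inPlaneRoots Fr 1).card : ℝ) *
          (220 * ((X.filter fun s => h + (R₀ + 1) + 1 ≤ s 2 ∧ s 2 ≤ h + (R₀ + 1) + 1 + 1 ∧
              (ρ - 1 - 2) ^ 2 < s 0 ^ 2 + s 1 ^ 2).card : ℝ) +
            220 * ((X.filter fun s => -(R₀ + 1) - 1 - 1 ≤ s 2 ∧ s 2 < -(R₀ + 1) - 1 ∧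
              (ρ - 1 - 1) ^ 2 < s 0 ^ 2 + s 1 ^ 2).card : ℝ)) := by
    exact_mod_cast hkey
  linarith only [hkey', key]

end Summit.Ventures.Crystal3D.Theorems

end
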